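import Mathlib.AlgebraicGeometry.Morphisms.ClosedImmersion
import Mathlib.AlgebraicGeometry.PullbackCarrier
import Mathlib.RingTheory.WittVector.Teichmuller
import Mathlib.Topology.KrullDimension
import Literature.AlgebraicGeometry.Motives.CrystallineRealization
import HarnessLib

/-!
# The special fibre of a `W(k)`-scheme is the zero locus of `p`, embedded as a closed subspace

Let `k` be a commutative ring of characteristic `p`, `W = W(k)` (Mathlib `WittVector p k`) and `𝒳`
a `W`-scheme (`SchemeOver (WittVector p k)`), with special fibre `X_k = 𝒳 ×_W Spec k ⟶ 𝒳`
(`WittScheme.specialFibre`, `WittScheme.specialFibreι` of `Motives/CrystallineRealization`: base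
change along the residue map `W → k`, `x ↦ x₀`) and thickenings `X_n = 𝒳 ⊗_W W/pⁿ ⟶ 𝒳`
(`WittScheme.thickening`, `WittScheme.thickeningι`). This file records the elementary geometry of
these maps (Hartshorne II.3 and Ex. II.3.11: closed immersions, base extension; Berthelot–Ogus
1983, (2.4): "`X₀ = X ⊗ k`"); everything is PROVED, theorems only:

* `isClosedImmersion_specialFibreι`, `isClosedImmersion_specialFibreToThickening` — the maps
  `X_k ⟶ 𝒳`, `X_k ⟶ X_{n+1}` are closed immersions (base change of `Spec` of the surjections
  `W ↠ k`, `W ↠ W/pⁿ`, Mathlib `IsClosedImmersion.spec_of_surjective`,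
  `IsClosedImmersion.isStableUnderBaseChange`, `.of_comp_isClosedImmersion`; `X_n ⟶ 𝒳` and
  `X_m ⟶ X_n` are stated Summit-side and only used inline here); hence
  `isClosedEmbedding_specialFibreι`, `isClosed_range_specialFibreι` (same for `thickeningι`);
* `ker_constantCoeff_le_iff_mem` — for `char k = p`, a prime ideal of `W(k)` contains
  `ker (W(k) → k)` iff it contains `p` (no perfectness needed: an element with `x₀ = 0` is a
  Verschiebung `V y`, and `V(y)² = V(y²)·p`), whence `range_comap_constantCoeff`: the image of
  `Spec k → Spec W(k)` is `V(p)`;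
* `range_specialFibreι_eq_compl_basicOpen` — **the special fibre is the zero locus of the global
  function `p`**: `range (X_k ⟶ 𝒳) = 𝒳 ∖ D(p)` with `D(p) = 𝒳.basicOpen (p : Γ(𝒳, ⊤))`
  (Mathlib `Scheme.Pullback.range_fst`, `Scheme.preimage_basicOpen_top`), pointwise
  `mem_range_specialFibreι_iff_mem` (`x ∈ X_k ↔ p ∈ 𝔭_{f(x)}`, `f : 𝒳 → Spec W` the structure
  map); the same for the thickenings with NO hypothesis on `k`,
  `range_thickeningι_succ_eq_compl_basicOpen`, and `range_thickeningι_succ_eq_range_specialFibreι`;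
* `topologicalKrullDim_range_specialFibreι`, `topologicalKrullDim_compl_basicOpen_natCast` — the
  subspace `range (X_k ⟶ 𝒳) = 𝒳 ∖ D(p)` of `𝒳` is homeomorphic to `X_k` (Mathlib
  `IsEmbedding.toHomeomorph`), so its Krull dimension is that of `X_k`.

## Why

The quotient sheaves `Ωʲ_{𝒳/W}/pᵉ` on a `p`-adic scheme `𝒳` are abelian sheaves on `|𝒳|` killed
by `pᵉ`, hence supported on the zero locus `𝒳 ∖ D(p)` of `p`; to bound their cohomology by
Grothendieck vanishing WITH SUPPORTS one needs that this support is the image of the closed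
immersion `X_k ⟶ 𝒳` and has, as a subspace, the dimension of `X_k`: the two facts supplied here.

## Not here

Dimension theory of `X_k` itself (`dim X_k = d` for a smooth proper model); the comparison of the
subspace dimension with the dimension-with-supports of Grothendieck vanishing; the description
`range (X_k ⟶ 𝒳) = f⁻¹(closed point)` for `k` a perfect FIELD. The companion file
`Motives/GrothendieckExistenceWittProofs` proves, for `k` PERFECT,
`WittScheme.range_specialFibreι : range (X_k ⟶ 𝒳) = {x | (p) ≤ 𝔭_{f(x)}}` (Mathlib
`WittVector.ker_constantCoeff`); the names here are disjoint from it, the hypotheses weaker.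

## References

* R. Hartshorne, *Algebraic Geometry*, GTM 52 (1977), II.3 and Ex. II.3.11 (a). [Hartshorne1977]
* P. Berthelot, A. Ogus, *F-isocrystals and de Rham cohomology. I*, Invent. Math. 72 (1983), (2.4).
  [BerthelotOgus1983]
-/

open CategoryTheory AlgebraicGeometry Limits Topology

universe u

namespace Literature.AlgebraicGeometry.Motives

/-! ### Witt vectors: the image of `Spec k → Spec W(k)` is `V(p)` -/

section Witt

variable {p : ℕ} [Fact p.Prime] {k : Type u} [CommRing k]

/-- `Spec k ⟶ Spec W(k)` is a closed immersion: the residue map `W(k) → k`, `x ↦ x₀`, is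
surjective (Teichmüller lifts, Mathlib `WittVector.constantCoeff_surjective`). [folklore] -/
theorem isClosedImmersion_specMap_constantCoeff :
    IsClosedImmersion
      (Spec.map (CommRingCat.ofHom (WittVector.constantCoeff : WittVector p k →+* k))) :=
  IsClosedImmersion.spec_of_surjective _ (WittVector.constantCoeff_surjective p)

/-- `Spec W/pⁿ ⟶ Spec W(k)` is a closed immersion. [folklore] -/
theorem isClosedImmersion_specMap_wittQuot (n : ℕ) :
    IsClosedImmersion
      (Spec.map (CommRingCat.ofHom (algebraMap (WittVector p k) (wittQuot p k n)))) :=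
  IsClosedImmersion.spec_of_surjective _ Ideal.Quotient.mk_surjective

/-- A prime of `W(k)` lies in the image of `Spec W/pⁿ⁺¹ → Spec W(k)` (Mathlib `PrimeSpectrum.comap`,
the underlying map of `Spec.map` by `rfl`) iff it contains `p` (`V(pⁿ⁺¹) = V(p)` on primes; no
hypothesis on `k`). [folklore] -/
theorem mem_range_comap_wittQuot_iff (n : ℕ) (x : PrimeSpectrum (WittVector p k)) :
    x ∈ Set.range (PrimeSpectrum.comap (algebraMap (WittVector p k) (wittQuot p k (n + 1)))) ↔
      (p : WittVector p k) ∈ x.asIdeal := by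
  rw [Ideal.Quotient.algebraMap_eq, range_comap_of_surjective _ _ Ideal.Quotient.mk_surjective,
    Ideal.mk_ker, PrimeSpectrum.mem_zeroLocus, SetLike.coe_subset_coe,
    Ideal.IsPrime.pow_le_iff (Nat.succ_ne_zero n), Ideal.span_singleton_le_iff_mem]

variable [CharP k p]

/-- In `W(k)`, `char k = p`: `V(y) · V(y) = V(y²) · p` (projection formula `V(x · F y) = V(x) · y`,
`F V = p` and `V F = p`: Mathlib `WittVector.verschiebung_mul_frobenius`, `frobenius_verschiebung`,
`verschiebung_frobenius`). [folklore] -/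
theorem verschiebung_mul_verschiebung_self (y : WittVector p k) :
    WittVector.verschiebung y * WittVector.verschiebung y =
      WittVector.verschiebung (y * y) * p := by
  rw [← WittVector.verschiebung_mul_frobenius y (WittVector.verschiebung y),
    WittVector.frobenius_verschiebung, ← mul_assoc, ← WittVector.frobenius_verschiebung (y * y),
    WittVector.verschiebung_frobenius]

/-- For `char k = p`, a prime ideal of `W(k)` contains the kernel of the residue map `W(k) → k` iff
it contains `p`: `p ↦ 0` in `k`; conversely an element with `x₀ = 0` is a Verschiebung `V y`
(Mathlib `WittVector.eq_iterate_verschiebung`) and `V(y)² = V(y²) · p`. (For `k` PERFECT the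
kernel is `(p)` itself, Mathlib `WittVector.ker_constantCoeff`; not needed here.) [folklore] -/
theorem ker_constantCoeff_le_iff_mem {q : Ideal (WittVector p k)} (hq : q.IsPrime) :
    RingHom.ker (WittVector.constantCoeff : WittVector p k →+* k) ≤ q ↔
      (p : WittVector p k) ∈ q := by
  refine ⟨fun h => h ?_, fun hp x hx => ?_⟩
  · rw [RingHom.mem_ker]
    exact constantCoeff_natCast_prime p k
  · have hx0 : ∀ i < 1, x.coeff i = 0 := fun i hi => by
      obtain rfl : i = 0 := Nat.lt_one_iff.mp hi
      rwa [RingHom.mem_ker, WittVector.constantCoeff_apply] at hx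
    have hxV : x = WittVector.verschiebung (x.shift 1) := by
      simpa using WittVector.eq_iterate_verschiebung hx0
    refine hq.mem_of_pow_mem 2 ?_
    rw [hxV, pow_two, verschiebung_mul_verschiebung_self]
    exact q.mul_mem_left _ hp

/-- A prime of `W(k)` lies in the image of `Spec k → Spec W(k)` iff it contains `p` (`char k = p`;
the image of `Spec` of a surjection is `V(ker)`, Mathlib `range_comap_of_surjective`). [folklore] -/
theorem mem_range_comap_constantCoeff_iff (x : PrimeSpectrum (WittVector p k)) :
    x ∈ Set.range (PrimeSpectrum.comap (WittVector.constantCoeff : WittVector p k →+* k)) ↔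
      (p : WittVector p k) ∈ x.asIdeal := by
  rw [range_comap_of_surjective _ _ (WittVector.constantCoeff_surjective p),
    PrimeSpectrum.mem_zeroLocus, SetLike.coe_subset_coe]
  exact ker_constantCoeff_le_iff_mem x.isPrime

/-- The image of `Spec k → Spec W(k)` is the zero locus `V(p)` (`char k = p`). [folklore] -/
theorem range_comap_constantCoeff :
    Set.range (PrimeSpectrum.comap (WittVector.constantCoeff : WittVector p k →+* k)) =
      PrimeSpectrum.zeroLocus {(p : WittVector p k)} := by
  ext x
  rw [mem_range_comap_constantCoeff_iff, PrimeSpectrum.mem_zeroLocus, Set.singleton_subset_iff,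
    SetLike.mem_coe]

end Witt

namespace WittScheme

/-! ### The tower `X_k ⟶ X_{n+1} ⟶ 𝒳` consists of closed immersions -/

section ClosedImmersion

variable {p : ℕ} [Fact p.Prime] {k : Type u} [CommRing k] (𝒳 : SchemeOver (WittVector p k))

/-- **The special fibre `X_k ⟶ 𝒳` is a closed immersion**: base change of the closed immersion
`Spec k ⟶ Spec W(k)` along the structure map `𝒳 → Spec W(k)` (Hartshorne Ex. II.3.11 (a); Mathlib
`IsClosedImmersion.isStableUnderBaseChange`). [folklore] -/
theorem isClosedImmersion_specialFibreι : IsClosedImmersion (specialFibreι 𝒳) :=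
  MorphismProperty.pullback_fst (P := @IsClosedImmersion) _ _
    isClosedImmersion_specMap_constantCoeff

/-- The map `X_k ⟶ X_{n+1}` is a closed immersion: `X_k ⟶ X_{n+1} ⟶ 𝒳 = X_k ⟶ 𝒳` with
`X_k ⟶ 𝒳` and `X_{n+1} ⟶ 𝒳` closed immersions (the latter as the base change of
`Spec W/pⁿ⁺¹ ⟶ Spec W`, `isClosedImmersion_specMap_wittQuot`; it is stated on its own Summit-side),
and cancellation (Mathlib `IsClosedImmersion.of_comp_isClosedImmersion`). [folklore] -/
theorem isClosedImmersion_specialFibreToThickening [CharP k p] (n : ℕ) :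
    IsClosedImmersion (specialFibreToThickening 𝒳 n) := by
  haveI : IsClosedImmersion (thickeningι 𝒳 (n + 1)) :=
    MorphismProperty.pullback_fst (P := @IsClosedImmersion) _ _
      (isClosedImmersion_specMap_wittQuot (n + 1))
  haveI : IsClosedImmersion (specialFibreToThickening 𝒳 n ≫ thickeningι 𝒳 (n + 1)) := by
    rw [specialFibreToThickening_ι]
    exact isClosedImmersion_specialFibreι 𝒳
  exact IsClosedImmersion.of_comp_isClosedImmersion _ (thickeningι 𝒳 (n + 1))

/-- The special fibre `X_k ⟶ 𝒳` is a closed embedding of underlying spaces. [folklore] -/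
theorem isClosedEmbedding_specialFibreι : IsClosedEmbedding (specialFibreι 𝒳) :=
  haveI := isClosedImmersion_specialFibreι 𝒳
  (specialFibreι 𝒳).isClosedEmbedding

/-- The thickening `X_n ⟶ 𝒳` is a closed embedding of underlying spaces (it is a closed immersion:
the base change of `Spec W/pⁿ ⟶ Spec W`, `isClosedImmersion_specMap_wittQuot`). [folklore] -/
theorem isClosedEmbedding_thickeningι (n : ℕ) : IsClosedEmbedding (thickeningι 𝒳 n) :=
  haveI : IsClosedImmersion (thickeningι 𝒳 n) :=
    MorphismProperty.pullback_fst (P := @IsClosedImmersion) _ _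
      (isClosedImmersion_specMap_wittQuot n)
  (thickeningι 𝒳 n).isClosedEmbedding

/-- The image of the special fibre is a closed subset of `𝒳`. [folklore] -/
theorem isClosed_range_specialFibreι : IsClosed (Set.range (specialFibreι 𝒳)) :=
  (isClosedEmbedding_specialFibreι 𝒳).isClosed_range

/-- The image of a thickening is a closed subset of `𝒳`. [folklore] -/
theorem isClosed_range_thickeningι (n : ℕ) : IsClosed (Set.range (thickeningι 𝒳 n)) :=
  (isClosedEmbedding_thickeningι 𝒳 n).isClosed_range

/-- **The image of the special fibre, as a subspace of `𝒳`, has the Krull dimension of `X_k`**: a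
closed embedding is a homeomorphism onto its image (Mathlib `IsEmbedding.toHomeomorph`,
`IsHomeomorph.topologicalKrullDim_eq`). [folklore] -/
theorem topologicalKrullDim_range_specialFibreι :
    topologicalKrullDim (Set.range (specialFibreι 𝒳)) =
      topologicalKrullDim (specialFibre 𝒳).left :=
  (IsHomeomorph.topologicalKrullDim_eq _
    (isClosedEmbedding_specialFibreι 𝒳).isEmbedding.toHomeomorph.isHomeomorph).symm

/-- The image of a thickening, as a subspace of `𝒳`, has the Krull dimension of `X_n`. [folklore] -/
theorem topologicalKrullDim_range_thickeningι (n : ℕ) :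
    topologicalKrullDim (Set.range (thickeningι 𝒳 n)) =
      topologicalKrullDim (thickening 𝒳 n).left :=
  (IsHomeomorph.topologicalKrullDim_eq _
    (isClosedEmbedding_thickeningι 𝒳 n).isEmbedding.toHomeomorph.isHomeomorph).symm

end ClosedImmersion

/-! ### The special fibre is the zero locus of the global function `p` -/

section ZeroLocus

variable {p : ℕ} [Fact p.Prime] {k : Type u} [CommRing k] (𝒳 : SchemeOver (WittVector p k))

/-- The global function `p` on `𝒳` is invertible at `x` iff `x` does NOT lie over `V(p) ⊆ Spec W`:
`𝒳.basicOpen p = f⁻¹(D(p))` for the structure map `f : 𝒳 → Spec W` (Mathlib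
`Scheme.preimage_basicOpen_top`, `basicOpen_eq_of_affine`). [folklore] -/
theorem mem_basicOpen_natCast_iff (x : 𝒳.left) :
    x ∈ 𝒳.left.basicOpen (p : Γ(𝒳.left, ⊤)) ↔ (p : WittVector p k) ∉ (𝒳.hom x).asIdeal := by
  have h : 𝒳.left.basicOpen (p : Γ(𝒳.left, ⊤)) =
      𝒳.hom ⁻¹ᵁ (Spec (CommRingCat.of (WittVector p k))).basicOpen
        ((Scheme.ΓSpecIso (CommRingCat.of (WittVector p k))).inv (p : WittVector p k)) := by
    rw [Scheme.preimage_basicOpen_top, map_natCast, map_natCast]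
  rw [h, basicOpen_eq_of_affine]
  exact PrimeSpectrum.mem_basicOpen _ _

/-- A point of `𝒳` lies on the thickening `X_{n+1}` iff it lies over `V(p)`, i.e. iff
`p ∈ 𝔭_{f(x)}` (the image of a base change is the preimage of the image, Mathlib
`Scheme.Pullback.range_fst`; no hypothesis on `k`). [folklore] -/
theorem mem_range_thickeningι_succ_iff_mem (n : ℕ) (x : 𝒳.left) :
    x ∈ Set.range (thickeningι 𝒳 (n + 1)) ↔ (p : WittVector p k) ∈ (𝒳.hom x).asIdeal := by
  change x ∈ Set.range (pullback.fst 𝒳.hom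
    (Spec.map (CommRingCat.ofHom (algebraMap (WittVector p k) (wittQuot p k (n + 1)))))) ↔ _
  rw [Scheme.Pullback.range_fst, Set.mem_preimage]
  exact mem_range_comap_wittQuot_iff n (𝒳.hom x)

/-- **The thickening `X_{n+1} ⟶ 𝒳` has image the zero locus of the global function `p`**:
`range (X_{n+1} ⟶ 𝒳) = 𝒳 ∖ 𝒳.basicOpen p` (no hypothesis on `k`). [folklore] -/
theorem range_thickeningι_succ_eq_compl_basicOpen (n : ℕ) :
    Set.range (thickeningι 𝒳 (n + 1)) =
      ((𝒳.left.basicOpen (p : Γ(𝒳.left, ⊤)) : Set 𝒳.left))ᶜ := by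
  ext x
  rw [mem_range_thickeningι_succ_iff_mem, Set.mem_compl_iff, SetLike.mem_coe,
    mem_basicOpen_natCast_iff, not_not]

variable [CharP k p]

/-- A point of `𝒳` lies on the special fibre `X_k` iff it lies over `V(p) ⊆ Spec W(k)`, i.e. iff
`p ∈ 𝔭_{f(x)}` (`char k = p`; Mathlib `Scheme.Pullback.range_fst` and
`mem_range_comap_constantCoeff_iff`). [folklore] -/
theorem mem_range_specialFibreι_iff_mem (x : 𝒳.left) :
    x ∈ Set.range (specialFibreι 𝒳) ↔ (p : WittVector p k) ∈ (𝒳.hom x).asIdeal := by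
  change x ∈ Set.range (pullback.fst 𝒳.hom
    (Spec.map (CommRingCat.ofHom (WittVector.constantCoeff : WittVector p k →+* k)))) ↔ _
  rw [Scheme.Pullback.range_fst, Set.mem_preimage]
  exact mem_range_comap_constantCoeff_iff (𝒳.hom x)

/-- **The special fibre is the zero locus of the global function `p`**:
`range (X_k ⟶ 𝒳) = 𝒳 ∖ 𝒳.basicOpen (p : Γ(𝒳, ⊤))` as subsets of `𝒳` (`char k = p`;
Berthelot–Ogus 1983, (2.4), `X₀ = X ⊗ k ⊆ X`). [folklore] -/
theorem range_specialFibreι_eq_compl_basicOpen :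
    Set.range (specialFibreι 𝒳) = ((𝒳.left.basicOpen (p : Γ(𝒳.left, ⊤)) : Set 𝒳.left))ᶜ := by
  ext x
  rw [mem_range_specialFibreι_iff_mem, Set.mem_compl_iff, SetLike.mem_coe,
    mem_basicOpen_natCast_iff, not_not]

/-- Every thickening `X_{n+1} ⟶ 𝒳` has the same image as the special fibre `X_k ⟶ 𝒳` (both are
the zero locus of `p`; `char k = p`). [folklore] -/
theorem range_thickeningι_succ_eq_range_specialFibreι (n : ℕ) :
    Set.range (thickeningι 𝒳 (n + 1)) = Set.range (specialFibreι 𝒳) := by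
  rw [range_thickeningι_succ_eq_compl_basicOpen, range_specialFibreι_eq_compl_basicOpen]

/-- The zero locus `𝒳 ∖ D(p)` of `p`, as a subspace of `𝒳`, has the Krull dimension of the special
fibre `X_k` (the form consumed by Grothendieck vanishing with supports in `𝒳 ∖ D(p)`). [folklore] -/
theorem topologicalKrullDim_compl_basicOpen_natCast :
    topologicalKrullDim ↥((𝒳.left.basicOpen (p : Γ(𝒳.left, ⊤)) : Set 𝒳.left))ᶜ =
      topologicalKrullDim (specialFibre 𝒳).left := by
  rw [← range_specialFibreι_eq_compl_basicOpen]
  exact topologicalKrullDim_range_specialFibreι 𝒳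

end ZeroLocus

end WittScheme

end Literature.AlgebraicGeometry.Motives
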